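import Summits.Ventures.PercRepro.ProfilePointedCircuitClassesStarSharpD2

/-! # The parallel-twin-of-`e` regime (D1) of `StarNineSharp`: the dictionary, III — the six-point count and the
factor-two theorem (p5 g53, §80 ADD 9(c)).  The predicates of `sixpoint_lemma` (StarSharpZ) with `B = {e, b′}`,
`Q = E₇ − e − x − f` and the marks `f`, `b` are translated into membership in `BI₄(N)` of the Type I sets
`insert b {e, u, v}`, `insert b {e, f, u}` and their ON/OFF status `ρ(W + b′) ≤ 4`; the ON Type I sets of the left
family are counted twice by the ordered pairs, and the counts are assembled into
`#{W : e ∈ W ∌ f, b′ ∉ W} ≤ 2·#{W : e, f ∈ W, b′ ∉ W}`. -/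

open scoped Matroid

namespace PercRepro.Cogirth

open Finset ThmH Skew Shadow Profile

variable {α : Type} [DecidableEq α] {N : Matroid α} [N.Finite]

section StarSharpD3

/-- `#(insert e (insert f Z)) ≤ #Z + 2`. -/
theorem card_insert_insert_le (e f : α) (Z : Finset α) : (insert e (insert f Z)).card ≤ Z.card + 2 :=
  (card_insert_le _ _).trans (Nat.succ_le_succ (card_insert_le _ _))

/-- **The relation of the six-point lemma**, translated: for `u ≠ v ∈ Q`, the pair `(u, v)` is counted iff
`insert b {e, u, v}` is a bi-independent ON set. -/
theorem sixpoint_R_iff {b b' e x f u v : α} (h : SeriesPair N b b') (hn : (gr N).card = 9)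
    (he : e ∈ ((gr N).erase b).erase b') (hx : x ∈ ((gr N).erase b).erase b') (hf : f ∈ ((gr N).erase b).erase b')
    (hxe : x ≠ e) (hfe : f ≠ e) (hfx : f ≠ x) (he1 : rk N {e} = 1) (hx1 : rk N {x} = 1) (hex : rk N {e, x} = 1)
    (hu : u ∈ (((((gr N).erase b).erase b').erase e).erase x).erase f)
    (hv : v ∈ (((((gr N).erase b).erase b').erase e).erase x).erase f) (huv : u ≠ v) :
    ((rk N ({e, b'} : Finset α) + 2 ≤ rk N ({u, v} ∪ {e, b'}) ∧
      rk N ({e, b'} : Finset α) + 3 ≤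
        rk N (insert f ((((((((gr N).erase b).erase b').erase e).erase x).erase f).erase u).erase v) ∪ {e, b'})) ∧
      rk N ({u, v, b} ∪ {e, b'}) ≤ rk N ({e, b'} : Finset α) + 2) ↔
    (insert b {e, u, v} ∈ biIndepSets N 4 ∧ rk N (insert b' (insert b {e, u, v})) ≤ 4) := by
  obtain ⟨huf, hux, hue, huE⟩ := mem_Q_unpack hu
  obtain ⟨hvf, hvx, hve, hvE⟩ := mem_Q_unpack hv
  have hZE : (((((((gr N).erase b).erase b').erase e).erase x).erase f).erase u).erase v ⊆ ((gr N).erase b).erase b' := fun z hz =>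
    (mem_Q_unpack (mem_of_mem_erase (mem_of_mem_erase hz))).2.2.2
  have hZc : ((((((((gr N).erase b).erase b').erase e).erase x).erase f).erase u).erase v).card = 2 := by
    rw [card_erase_of_mem (mem_erase.2 ⟨huv.symm, hv⟩), card_erase_of_mem hu,
      card_erase_of_mem (mem_erase.2 ⟨hfx, mem_erase.2 ⟨hfe, hf⟩⟩), card_erase_of_mem (mem_erase.2 ⟨hxe, hx⟩),
      card_erase_of_mem he, card_erase_of_mem (mem_erase.2 ⟨h.2.2.1.symm, h.2.1⟩), card_erase_of_mem h.1, hn]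
  rw [rk_pair_eb'_eq_two h he he1, rk_union_eb'_eq h he (insert_subset huE (singleton_subset_iff.2 hvE)),
    rk_union_eb'_eq h he (insert_subset hf hZE), ← insert_b'_insert_b_eq,
    typeI_mem_iff h hn he hx hf hxe hfe hfx he1 hx1 hex hu hv huv]
  have h1 := rk_le_card' (M := N) ({e, u, v} : Finset α)
  have h2 := card_triple_le_three e u v
  have h3 := rk_le_card' (M := N) (insert e (insert f ((((((((gr N).erase b).erase b').erase e).erase x).erase f).erase u).erase v)))
  have h4 := card_insert_insert_le e f ((((((((gr N).erase b).erase b').erase e).erase x).erase f).erase u).erase v)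
  constructor
  · rintro ⟨⟨ha, hb⟩, hc⟩
    exact ⟨⟨by omega, by omega⟩, hc⟩
  · rintro ⟨⟨ha, hb⟩, hc⟩
    exact ⟨⟨by omega, by omega⟩, hc⟩

/-- **The point predicates of the six-point lemma**, translated: for `u ∈ Q`, `G u` iff `insert b {e, f, u}` is
bi-independent, and `H u` iff it is ON. -/
theorem sixpoint_G_iff {b b' e x f u : α} (h : SeriesPair N b b') (hn : (gr N).card = 9)
    (he : e ∈ ((gr N).erase b).erase b') (hx : x ∈ ((gr N).erase b).erase b') (hf : f ∈ ((gr N).erase b).erase b')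
    (hxe : x ≠ e) (hfe : f ≠ e) (hfx : f ≠ x) (he1 : rk N {e} = 1) (hx1 : rk N {x} = 1) (hex : rk N {e, x} = 1)
    (hu : u ∈ (((((gr N).erase b).erase b').erase e).erase x).erase f) :
    (rk N ({e, b'} : Finset α) + 2 ≤ rk N ({f, u} ∪ {e, b'}) ∧
      rk N ({e, b'} : Finset α) + 3 ≤ rk N ((((((((gr N).erase b).erase b').erase e).erase x).erase f).erase u) ∪ {e, b'})) ↔
    insert b {e, f, u} ∈ biIndepSets N 4 := by
  obtain ⟨huf, hux, hue, huE⟩ := mem_Q_unpack hu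
  have hZE : (((((((gr N).erase b).erase b').erase e).erase x).erase f).erase u) ⊆ ((gr N).erase b).erase b' := fun z hz => (mem_Q_unpack (mem_of_mem_erase hz)).2.2.2
  have hZc : ((((((((gr N).erase b).erase b').erase e).erase x).erase f).erase u)).card = 3 := by
    rw [card_erase_of_mem hu, card_erase_of_mem (mem_erase.2 ⟨hfx, mem_erase.2 ⟨hfe, hf⟩⟩),
      card_erase_of_mem (mem_erase.2 ⟨hxe, hx⟩), card_erase_of_mem he,
      card_erase_of_mem (mem_erase.2 ⟨h.2.2.1.symm, h.2.1⟩), card_erase_of_mem h.1, hn]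
  rw [rk_pair_eb'_eq_two h he he1, rk_union_eb'_eq h he (insert_subset hf (singleton_subset_iff.2 huE)),
    rk_union_eb'_eq h he hZE, typeI_f_mem_iff h hn he hx hf hxe hfe hfx he1 hx1 hex hu]
  have h1 := rk_le_card' (M := N) ({e, f, u} : Finset α)
  have h2 := card_triple_le_three e f u
  have h3 := rk_le_card' (M := N) (insert e (((((((gr N).erase b).erase b').erase e).erase x).erase f).erase u))
  have h4 : (insert e (((((((gr N).erase b).erase b').erase e).erase x).erase f).erase u)).card ≤ 4 := (card_insert_le _ _).trans (by rw [hZc])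
  constructor
  · rintro ⟨ha, hb⟩
    exact ⟨by omega, by omega⟩
  · rintro ⟨ha, hb⟩
    exact ⟨by omega, by omega⟩

/-- `H u` translated. -/
theorem sixpoint_H_iff {b b' e f u : α} :
    rk N ({f, u, b} ∪ {e, b'}) ≤ rk N ({e, b'} : Finset α) + 2 ↔
      rk N (insert b' (insert b {e, f, u})) ≤ rk N ({e, b'} : Finset α) + 2 := by
  rw [insert_b'_insert_b_f_eq]

/-- `{e, v, u} = {e, u, v}`. -/
theorem triple_swap23' (e u v : α) : ({e, v, u} : Finset α) = {e, u, v} := by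
  rw [pair_comm]

/-- **(C3)**: the ON Type I sets of the left family are counted twice by the ordered pairs of the six-point lemma. -/
theorem two_mul_card_typeI_on_le {b b' e x f : α} (h : SeriesPair N b b') (hn : (gr N).card = 9)
    (he : e ∈ ((gr N).erase b).erase b') (hx : x ∈ ((gr N).erase b).erase b') (hf : f ∈ ((gr N).erase b).erase b')
    (hxe : x ≠ e) (hfe : f ≠ e) (hfx : f ≠ x) (he1 : rk N {e} = 1) (hx1 : rk N {x} = 1) (hex : rk N {e, x} = 1) :
    2 * ((biIndepSets N 4).filter (fun W => (((e ∈ W ∧ f ∉ W) ∧ b' ∉ W) ∧ b ∈ W) ∧ rk N (insert b' W) ≤ 4)).card ≤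
      ((((((((gr N).erase b).erase b').erase e).erase x).erase f) ×ˢ
          ((((((gr N).erase b).erase b').erase e).erase x).erase f)).filter (fun p => p.1 ≠ p.2 ∧
        ((rk N ({e, b'} : Finset α) + 2 ≤ rk N ({p.1, p.2} ∪ {e, b'}) ∧
          rk N ({e, b'} : Finset α) + 3 ≤
            rk N (insert f ((((((((gr N).erase b).erase b').erase e).erase x).erase f).erase p.1).erase p.2) ∪ {e, b'})) ∧
          rk N ({p.1, p.2, b} ∪ {e, b'}) ≤ rk N ({e, b'} : Finset α) + 2))).card := by
  have hbf : b ≠ f := fun h' => (mem_erase.1 (mem_erase.1 hf).2).1 h'.symm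
  have hbe : b ≠ e := fun h' => (mem_erase.1 (mem_erase.1 he).2).1 h'.symm
  have hb'f : b' ≠ f := fun h' => (mem_erase.1 hf).1 h'.symm
  have hb'e : b' ≠ e := fun h' => (mem_erase.1 he).1 h'.symm
  have hbb' : b ≠ b' := h.2.2.1
  set T := (biIndepSets N 4).filter (fun W => (((e ∈ W ∧ f ∉ W) ∧ b' ∉ W) ∧ b ∈ W) ∧ rk N (insert b' W) ≤ 4) with hT
  set P := ((((((gr N).erase b).erase b').erase e).erase x).erase f ×ˢ
      (((((gr N).erase b).erase b').erase e).erase x).erase f).filter (fun p : α × α => p.1 ≠ p.2 ∧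
        ((rk N ({e, b'} : Finset α) + 2 ≤ rk N ({p.1, p.2} ∪ {e, b'}) ∧
          rk N ({e, b'} : Finset α) + 3 ≤
            rk N (insert f ((((((((gr N).erase b).erase b').erase e).erase x).erase f).erase p.1).erase p.2) ∪ {e, b'})) ∧
          rk N ({p.1, p.2, b} ∪ {e, b'}) ≤ rk N ({e, b'} : Finset α) + 2)) with hP
  have hmaps : ∀ p ∈ P, insert b ({e, p.1, p.2} : Finset α) ∈ T := by
    intro p hp
    rw [hP, mem_filter, mem_product] at hp
    obtain ⟨⟨hu, hv⟩, huv, hR⟩ := hp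
    obtain ⟨hmem, hon⟩ := (sixpoint_R_iff h hn he hx hf hxe hfe hfx he1 hx1 hex hu hv huv).1 hR
    obtain ⟨huf, -, hue, -⟩ := mem_Q_unpack hu
    obtain ⟨hvf, -, hve, -⟩ := mem_Q_unpack hv
    rw [hT, mem_filter]
    refine ⟨hmem, ⟨⟨⟨mem_insert_of_mem (mem_insert_self e _), ?_⟩, ?_⟩, mem_insert_self b _⟩, hon⟩
    · simp only [mem_insert, mem_singleton, not_or]
      exact ⟨hbf.symm, hfe, huf.symm, hvf.symm⟩
    · simp only [mem_insert, mem_singleton, not_or]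
      exact ⟨hbb'.symm, hb'e, fun h' => (mem_erase.1 (mem_Q_unpack hu).2.2.2).1 h'.symm,
        fun h' => (mem_erase.1 (mem_Q_unpack hv).2.2.2).1 h'.symm⟩
  rw [card_eq_sum_card_fiberwise hmaps, mul_comm, ← smul_eq_mul, ← sum_const]
  apply sum_le_sum
  intro W hW
  rw [hT, mem_filter] at hW
  obtain ⟨hW, ⟨⟨⟨heW, hfW⟩, hb'W⟩, hbW⟩, hon⟩ := hW
  obtain ⟨u, v, hu, hv, huv, hWuv⟩ := typeI_structure h he hxe hex hW heW hfW hb'W hbW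
  have hRuv := (sixpoint_R_iff h hn he hx hf hxe hfe hfx he1 hx1 hex hu hv huv).2 ⟨hWuv ▸ hW, hWuv ▸ hon⟩
  have hRvu := (sixpoint_R_iff h hn he hx hf hxe hfe hfx he1 hx1 hex hv hu huv.symm).2
    (by rw [triple_swap23']; exact ⟨hWuv ▸ hW, hWuv ▸ hon⟩)
  refine (?_ : 2 ≤ ({(u, v), (v, u)} : Finset (α × α)).card).trans (card_le_card ?_)
  · rw [card_pair]
    intro h'
    exact huv (Prod.mk.inj h').1
  · intro p hp
    rw [mem_insert, mem_singleton] at hp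
    rw [mem_filter, hP, mem_filter, mem_product]
    rcases hp with rfl | rfl
    · exact ⟨⟨⟨hu, hv⟩, huv, hRuv⟩, hWuv.symm⟩
    · exact ⟨⟨⟨hv, hu⟩, huv.symm, hRvu⟩, by rw [triple_swap23']; exact hWuv.symm⟩

/-- Injectivity of `u ↦ insert b {e, f, u}` on `Q`. -/
theorem insert_b_efu_injOn {b b' e x f : α} :
    Set.InjOn (fun u => insert b ({e, f, u} : Finset α))
      ((((((gr N).erase b).erase b').erase e).erase x).erase f : Finset α) := by
  intro u₁ hu₁ u₂ _ heq
  simp only at heq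
  have hm : u₁ ∈ insert b ({e, f, u₂} : Finset α) := heq ▸ mem_insert_of_mem (mem_insert_of_mem
    (mem_insert_of_mem (mem_singleton_self u₁)))
  obtain ⟨huf, -, hue, huE⟩ := mem_Q_unpack (mem_coe.1 hu₁)
  simp only [mem_insert, mem_singleton] at hm
  rcases hm with h' | h' | h' | h'
  · exact absurd h' (mem_erase.1 (mem_erase.1 huE).2).1
  · exact absurd h' hue
  · exact absurd h' huf
  · exact h'

/-- **(C4, ON)**: the `G ∧ H` points inject into the ON Type I sets of the right family. -/
theorem card_GH_le {b b' e x f : α} (h : SeriesPair N b b') (hn : (gr N).card = 9)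
    (he : e ∈ ((gr N).erase b).erase b') (hx : x ∈ ((gr N).erase b).erase b') (hf : f ∈ ((gr N).erase b).erase b')
    (hxe : x ≠ e) (hfe : f ≠ e) (hfx : f ≠ x) (he1 : rk N {e} = 1) (hx1 : rk N {x} = 1) (hex : rk N {e, x} = 1) :
    (((((((gr N).erase b).erase b').erase e).erase x).erase f).filter (fun u =>
      (rk N ({e, b'} : Finset α) + 2 ≤ rk N ({f, u} ∪ {e, b'}) ∧
        rk N ({e, b'} : Finset α) + 3 ≤ rk N ((((((((gr N).erase b).erase b').erase e).erase x).erase f).erase u) ∪ {e, b'})) ∧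
        rk N ({f, u, b} ∪ {e, b'}) ≤ rk N ({e, b'} : Finset α) + 2)).card ≤
      ((biIndepSets N 4).filter (fun W => (((e ∈ W ∧ f ∈ W) ∧ b' ∉ W) ∧ b ∈ W) ∧ rk N (insert b' W) ≤ 4)).card := by
  have hb'f : b' ≠ f := fun h' => (mem_erase.1 hf).1 h'.symm
  have hb'e : b' ≠ e := fun h' => (mem_erase.1 he).1 h'.symm
  have hbb' : b ≠ b' := h.2.2.1
  apply card_le_card_of_injOn (fun u => insert b ({e, f, u} : Finset α))
  · intro u hu
    rw [mem_coe, mem_filter] at hu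
    obtain ⟨hu, hG, hH⟩ := hu
    rw [sixpoint_G_iff h hn he hx hf hxe hfe hfx he1 hx1 hex hu] at hG
    rw [sixpoint_H_iff, rk_pair_eb'_eq_two h he he1] at hH
    rw [mem_coe, mem_filter]
    refine ⟨hG, ⟨⟨⟨mem_insert_of_mem (mem_insert_self e _), mem_insert_of_mem (mem_insert_of_mem
      (mem_insert_self f _))⟩, ?_⟩, mem_insert_self b _⟩, hH⟩
    simp only [mem_insert, mem_singleton, not_or]
    exact ⟨hbb'.symm, hb'e, hb'f, fun h' => (mem_erase.1 (mem_Q_unpack hu).2.2.2).1 h'.symm⟩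
  · exact (insert_b_efu_injOn (N := N) (b := b) (b' := b') (e := e) (x := x) (f := f)).mono (fun u hu => mem_coe.2 (mem_filter.1 (mem_coe.1 hu)).1)

/-- **(C4, OFF)**: the `G ∧ ¬H` points inject into the OFF Type I sets of the right family. -/
theorem card_GnH_le {b b' e x f : α} (h : SeriesPair N b b') (hn : (gr N).card = 9)
    (he : e ∈ ((gr N).erase b).erase b') (hx : x ∈ ((gr N).erase b).erase b') (hf : f ∈ ((gr N).erase b).erase b')
    (hxe : x ≠ e) (hfe : f ≠ e) (hfx : f ≠ x) (he1 : rk N {e} = 1) (hx1 : rk N {x} = 1) (hex : rk N {e, x} = 1) :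
    (((((((gr N).erase b).erase b').erase e).erase x).erase f).filter (fun u =>
      (rk N ({e, b'} : Finset α) + 2 ≤ rk N ({f, u} ∪ {e, b'}) ∧
        rk N ({e, b'} : Finset α) + 3 ≤ rk N ((((((((gr N).erase b).erase b').erase e).erase x).erase f).erase u) ∪ {e, b'})) ∧
        ¬ rk N ({f, u, b} ∪ {e, b'}) ≤ rk N ({e, b'} : Finset α) + 2)).card ≤
      ((biIndepSets N 4).filter (fun W => (((e ∈ W ∧ f ∈ W) ∧ b' ∉ W) ∧ b ∈ W) ∧ ¬ rk N (insert b' W) ≤ 4)).card := by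
  have hb'f : b' ≠ f := fun h' => (mem_erase.1 hf).1 h'.symm
  have hb'e : b' ≠ e := fun h' => (mem_erase.1 he).1 h'.symm
  have hbb' : b ≠ b' := h.2.2.1
  apply card_le_card_of_injOn (fun u => insert b ({e, f, u} : Finset α))
  · intro u hu
    rw [mem_coe, mem_filter] at hu
    obtain ⟨hu, hG, hH⟩ := hu
    rw [sixpoint_G_iff h hn he hx hf hxe hfe hfx he1 hx1 hex hu] at hG
    rw [sixpoint_H_iff, rk_pair_eb'_eq_two h he he1] at hH
    rw [mem_coe, mem_filter]
    refine ⟨hG, ⟨⟨⟨mem_insert_of_mem (mem_insert_self e _), mem_insert_of_mem (mem_insert_of_mem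
      (mem_insert_self f _))⟩, ?_⟩, mem_insert_self b _⟩, hH⟩
    simp only [mem_insert, mem_singleton, not_or]
    exact ⟨hbb'.symm, hb'e, hb'f, fun h' => (mem_erase.1 (mem_Q_unpack hu).2.2.2).1 h'.symm⟩
  · exact (insert_b_efu_injOn (N := N) (b := b) (b' := b') (e := e) (x := x) (f := f)).mono (fun u hu => mem_coe.2 (mem_filter.1 (mem_coe.1 hu)).1)

/-- `E₇ − f = insert x (insert e Q)`. -/
theorem E7_erase_f_eq {b b' e x f : α} (he : e ∈ ((gr N).erase b).erase b') (hx : x ∈ ((gr N).erase b).erase b')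
    (hxe : x ≠ e) (hfe : f ≠ e) (hfx : f ≠ x) :
    (((gr N).erase b).erase b').erase f = insert x (insert e ((((((gr N).erase b).erase b').erase e).erase x).erase f)) := by
  set E7 := ((gr N).erase b).erase b' with hE7
  ext z
  simp only [mem_insert]
  constructor
  · intro hz
    obtain ⟨hzf, hzE⟩ := mem_erase.1 hz
    by_cases hzx : z = x
    · exact Or.inl hzx
    · by_cases hze : z = e
      · exact Or.inr (Or.inl hze)
      · exact Or.inr (Or.inr (mem_Q_pack hzf hzx hze hzE))
  · rintro (rfl | rfl | hz)
    · exact mem_erase.2 ⟨fun h' => hfx h'.symm, hx⟩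
    · exact mem_erase.2 ⟨fun h' => hfe h'.symm, he⟩
    · obtain ⟨hzf, -, -, hzE⟩ := mem_Q_unpack hz
      exact mem_erase.2 ⟨hzf, hzE⟩

/-- **(C5)**: `f` is not a coloop modulo `B`: `ρ(Q ∪ {e, b′}) ≥ 5` when `ρ(E₇ − f) = 4`. -/
theorem rk_Q_union_eb'_ge {b b' e x f : α} (h : SeriesPair N b b')
    (he : e ∈ ((gr N).erase b).erase b') (hx : x ∈ ((gr N).erase b).erase b')
    (hxe : x ≠ e) (hfe : f ≠ e) (hfx : f ≠ x) (he1 : rk N {e} = 1) (hx1 : rk N {x} = 1) (hex : rk N {e, x} = 1)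
    (hf' : rk N ((((gr N).erase b).erase b').erase f) = 4) :
    rk N ({e, b'} : Finset α) + 3 ≤ rk N ((((((gr N).erase b).erase b').erase e).erase x).erase f ∪ {e, b'}) := by
  have hQE : (((((gr N).erase b).erase b').erase e).erase x).erase f ⊆ ((gr N).erase b).erase b' := fun z hz =>
    (mem_Q_unpack hz).2.2.2
  rw [rk_pair_eb'_eq_two h he he1, rk_union_eb'_eq h he hQE]
  have hxg : x ∈ gr N := mem_of_mem_erase (mem_of_mem_erase hx)
  have heg : e ∈ gr N := mem_of_mem_erase (mem_of_mem_erase he)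
  rw [E7_erase_f_eq he hx hxe hfe hfx, rk_insert_eq_of_parallel' hxg heg hx1 he1 (by rw [pair_comm]; exact hex)
    (insert_subset heg (hQE.trans (fun z hz => mem_of_mem_erase (mem_of_mem_erase hz)))),
    insert_eq_of_mem (mem_insert_self e _)] at hf'
  omega

/-- **THE FACTOR-TWO COUNT OF THE D1 REGIME**: for `e ∥ x` (`x ∉ {f, b, b′}`) with `f` not a coloop of `E₇ − x`
(`ρ(E₇ − f) = 4`): `#{W ∈ BI₄(N) : e ∈ W ∌ f, b′ ∉ W} ≤ 2·#{W : e, f ∈ W, b′ ∉ W}`.  With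
`parallel_twin_e_core_iff` (StarSharpW) this is the inequality of `StarNineSharp` at `(e, f)` in case D1. -/
theorem parallel_twin_e_core {b b' e x f : α} (h : SeriesPair N b b') (hn : (gr N).card = 9)
    (he : e ∈ ((gr N).erase b).erase b') (hx : x ∈ ((gr N).erase b).erase b') (hf : f ∈ ((gr N).erase b).erase b')
    (hxe : x ≠ e) (hfe : f ≠ e) (hfx : f ≠ x) (he1 : rk N {e} = 1) (hx1 : rk N {x} = 1) (hex : rk N {e, x} = 1)
    (hf' : rk N ((((gr N).erase b).erase b').erase f) = 4) :
    ((biIndepSets N 4).filter (fun W => (e ∈ W ∧ f ∉ W) ∧ b' ∉ W)).card ≤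
      2 * ((biIndepSets N 4).filter (fun W => (e ∈ W ∧ f ∈ W) ∧ b' ∉ W)).card := by
  have hQg : (((((gr N).erase b).erase b').erase e).erase x).erase f ⊆ gr N := fun z hz =>
    mem_of_mem_erase (mem_of_mem_erase (mem_Q_unpack hz).2.2.2)
  have hQ4 : ((((((gr N).erase b).erase b').erase e).erase x).erase f).card = 4 := by
    rw [card_erase_of_mem (mem_erase.2 ⟨hfx, mem_erase.2 ⟨hfe, hf⟩⟩), card_erase_of_mem (mem_erase.2 ⟨hxe, hx⟩),
      card_erase_of_mem he, card_erase_of_mem (mem_erase.2 ⟨h.2.2.1.symm, h.2.1⟩), card_erase_of_mem h.1, hn]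
  have hBg : ({e, b'} : Finset α) ⊆ gr N :=
    insert_subset (mem_of_mem_erase (mem_of_mem_erase he)) (singleton_subset_iff.2 h.2.1)
  have hfg : f ∈ gr N := mem_of_mem_erase (mem_of_mem_erase hf)
  have hsix := sixpoint_lemma (N := N) (B := {e, b'}) (Q := (((((gr N).erase b).erase b').erase e).erase x).erase f)
    (f := f) (b := b) hBg hQg hfg h.1 hQ4 (rk_Q_union_eb'_ge h he hx hxe hfe hfx he1 hx1 hex hf')
  have hC3 := two_mul_card_typeI_on_le h hn he hx hf hxe hfe hfx he1 hx1 hex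
  have hGH := card_GH_le h hn he hx hf hxe hfe hfx he1 hx1 hex
  have hGnH := card_GnH_le h hn he hx hf hxe hfe hfx he1 hx1 hex
  have hA := card_typeII_le_card_typeI_off h hn he hx hf hxe hfe hfx he1 hx1 hex
  have hB := card_typeI_off_le_card_typeII h hn he hx hf hxe hfe hfx he1 hx1 hex
  -- the splits of the two families
  have hL1 := card_filter_add_card_filter_not (s := (biIndepSets N 4).filter (fun W => (e ∈ W ∧ f ∉ W) ∧ b' ∉ W))
    (fun W => b ∈ W)
  have hL2 := card_filter_add_card_filter_not
    (s := (biIndepSets N 4).filter (fun W => ((e ∈ W ∧ f ∉ W) ∧ b' ∉ W) ∧ b ∈ W)) (fun W => rk N (insert b' W) ≤ 4)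
  have hR1 := card_filter_add_card_filter_not (s := (biIndepSets N 4).filter (fun W => (e ∈ W ∧ f ∈ W) ∧ b' ∉ W))
    (fun W => b ∈ W)
  have hR2 := card_filter_add_card_filter_not
    (s := (biIndepSets N 4).filter (fun W => ((e ∈ W ∧ f ∈ W) ∧ b' ∉ W) ∧ b ∈ W)) (fun W => rk N (insert b' W) ≤ 4)
  simp only [filter_filter] at hL1 hL2 hR1 hR2
  omega

/-- **CASE D1 OF `StarNineSharp`**: when `e` has a parallel twin `x` (`x ∉ {f, b, b′}`) and `f` is not a coloop of
`N ∖ {b, b′}` (`ρ(E₇ − f) = 4`), the two-point inequality of `StarNineSharp` holds at `(e, f)`. -/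
theorem starNineSharp_instance_of_parallel_twin_e (hn : (gr N).card = 9) {b b' e f x : α} (h : SeriesPair N b b')
    (he : e ∈ gr N) (hx : x ∈ gr N) (hf : f ∈ gr N) (hex' : e ≠ x) (hef : e ≠ f) (hxf : x ≠ f) (heb : e ≠ b)
    (heb' : e ≠ b') (hxb : x ≠ b) (hxb' : x ≠ b') (hfb : f ≠ b) (hfb' : f ≠ b') (he1 : rk N {e} = 1)
    (hx1 : rk N {x} = 1) (hex : rk N {e, x} = 1) (hf' : rk N ((((gr N).erase b).erase b').erase f) = 4) :
    inCount N 4 e + thruCount N 4 {b', f} + thruCount N 4 {b', e, f} ≤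
      inCount N 4 f + thruCount N 4 {e, f} + thruCount N 4 {b', e} := by
  apply inCount_thru_le_of_parallel_twin_e 4 he hx hex' he1 hx1 hex hef hxf heb' hxb'
  exact parallel_twin_e_core h hn (mem_erase.2 ⟨heb', mem_erase.2 ⟨heb, he⟩⟩)
    (mem_erase.2 ⟨hxb', mem_erase.2 ⟨hxb, hx⟩⟩) (mem_erase.2 ⟨hfb', mem_erase.2 ⟨hfb, hf⟩⟩) hex'.symm hef.symm
    hxf.symm he1 hx1 hex hf'

end StarSharpD3

end PercRepro.Cogirth
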